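import Literature.IUT.HodgeTheaters.TemperedCoveringsCor23viOfPSCAbutmentOfCuspEdgeDict
import HarnessLib

/-!
# [IUTchI] Cor. 2.3 (vi): the pro-`Σ̂` incidence `hF` REDUCED to a TEMPERED-LEVEL finite-quotient separation
# (a sufficient criterion for the STRONG non-vacuity row R58; sequel of row R41)

S. Mochizuki, *Inter-universal Teichmüller theory I*, kurims manuscript (May 2020), §2, Cor. 2.3 (vi) p. 48 l. 6–16, proof
p. 49 l. 62–64 («by passing to pro-`Σ` completions») [cite: Mochizuki2012, Cor 2.3(vi) pp.48-49] (D-0012 claim key; series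
status DISPUTED; nothing of the series is asserted here); S. Mochizuki, *Semi-graphs of anabelioids*, Publ. RIMS **42**
(2006), §3 Prop. 3.6 (iii) p. 38 (the natural injection `π₁^temp(𝒢) ↪ π₁^temp(𝒢)^∧` into the profinite completion), §6
p. 69 (profinite completions) [cite: MochizukiSemiAnbd2006, Prop 3.6(iii) p.38].

PROOF-ONLY file (abc-iut cell, seat abc-iut-w4-d070 gen 12; self-announced count-neutral sequel of L5 ROWS #6 row R41, in
support of L5 ROWS #7 row R58 «COR23VI-HF-STRONG-NV» (holder abc-iut-L5-d5); cone row `IUTchI:Cor2.3(vi)` (discharged,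
RULINGS #118); no definition, no instance, no new `Prop` fact).

THE POINT.  The residual `hF` / `hFcusp` of the node (GAP-LEDGER G-w4d059-g8-1: «`ι(L) ⊆ g · closure ι(Π^tp_ℍ) · g⁻¹`
for an edge-like `L` of the edge `e` forces `e` to abut a vertex of `ℍ`») is a statement INSIDE THE PROFINITE
COMPLETION `ι : Π^tp_𝔾 ↪ Π̂_𝔾`.  This file proves, for ANY chart and ANY profinite completion (abc-iut-L3's
`IsProfiniteCompletion ι`: every open normal subgroup of finite index of `Π^tp_𝔾` is the inverse image of an open normal
subgroup of `Π̂_𝔾`), the elementary SEPARATION PRINCIPLE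

* `not_map_le_conj_closure_of_openNormal` — if some open normal finite-index `U ⊴ Π^tp_𝔾` contains `Π^tp_ℍ` but not `L`,
  then `ι(L) ⊄ g · closure ι(Π^tp_ℍ) · g⁻¹` for EVERY `g ∈ Π̂_𝔾` (`U = ι⁻¹(V)` with `V ⊴ Π̂_𝔾` open, hence closed and
  normal: the closure and all its conjugates stay inside `V`);

and hence the SUFFICIENT CRITERION, entirely at the tempered (indeed discrete-quotient) level, with no origin datum:

* `hatEdgeIncidence_of_openNormalSeparating` — **`hF` ⟸ `hsep`**: «for every edge `e` no branch of which abuts a vertex of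
  `ℍ` and every `L ∈ edgeLikeSubgroups c e` there is an open normal finite-index `U ⊴ Π^tp_𝔾` with `Π^tp_ℍ ≤ U`, `L ≰ U`»
  (equivalently: a continuous homomorphism to a FINITE group killing `Π^tp_ℍ` but not `L`);
  `hatCuspIncidence_of_openNormalSeparating` — the open-edge twin for `hFcusp`;
* `cor23vi_ofSpecialFibre_closureH_of_piData_of_openNormalSeparating_of_cuspOpenEdgeDict` — row `IUTchI:Cor2.3(vi)` over
  abc-iut-L3's origin record, print's record-vertex atom, ⟸ {`hdict : P.CuspOpenEdgeDict` (ORIGIN record datum),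
  `hsep` at the open edges (TEMPERED-LEVEL LAW)} — abc-iut-L5-d5's knit p496337 with `hFcusp` so supplied; and the
  group-form twin `…_verticialOver_piDataTpH_of_openNormalSeparating_of_cuspOpenEdgeDict` (via p497321).

USE (row R58).  At any model chart whose non-abutting edge groups are generated by free-basis elements independent of the
generators of `Π^tp_ℍ`, `hsep` is ONE homomorphism to `ℤ/p` per edge — so a STRONG (non-vacuous-hypothesis-free) `hF` at a
multi-vertex carrier costs no profinite argument.  HONEST CAVEAT.  `hsep` is SUFFICIENT, NOT NECESSARY: it FAILS, while
`hF` holds (by the profinite Bass–Serre argument print invokes), e.g. at a genus-`0` vertex `v ∉ ℍ` all of whose other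
edges run to `ℍ` — there the edge group of the remaining cusp lies in the normal closure of `Π^tp_ℍ` (`e⁻¹ = n₁ n₂`), so no
finite quotient separates it, although `ι(Π_e)` lies in no single conjugate of `Π̂_ℍ`.  So this file does NOT discharge
G-w4d059-g8-1; it isolates the part of it that is residual-finiteness bookkeeping from the part that is profinite
Bass–Serre.  Model-RELATIVE at the genuine datum; typed ≠ discharged for the [IUTchI] claim keys; nothing here bears on
[IUTchIII] Cor. 3.12 or asserts that abc is proved or refuted.
-/

noncomputable section

namespace Literature.IUT.HodgeTheaters

open _root_.Topology
open scoped Pointwise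
open Literature.AnabelianGeometry.SemiGraphs
open Literature.AnabelianGeometry.SemiGraphs.ProfiniteSemiGraph

universe u v

namespace StableCurveTemperedData

/-! ### 1. The separation principle in a profinite completion -/

section Chart

variable {𝒢 : ProfiniteSemiGraph.{u}} (c : TemperedPiChart 𝒢) {Ghat : Type v} [Group Ghat] [TopologicalSpace Ghat]
  [IsTopologicalGroup Ghat] {ι : c.G →ₜ* Ghat} (hι : IsProfiniteCompletion ι)
  (H : 𝒢.graph.Subgraph) (TpH : Subgroup c.G)

include hι in
/-- **Separation principle in the profinite completion** ([SemiAnbd] Prop. 3.6 (iii) / §6 p. 69: the open normal finite-index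
subgroups of `Π^tp_𝔾` are the traces of the open normal subgroups of `Π̂_𝔾`): if an open normal finite-index `U ⊴ Π^tp_𝔾`
contains `T` but not `L`, then `ι(L)` lies in NO `Π̂_𝔾`-conjugate of the closure of `ι(T)`.
[cite: MochizukiSemiAnbd2006, Prop 3.6(iii) p.38] -/
theorem not_map_le_conj_closure_of_openNormal (U : OpenNormalSubgroup c.G) (hU : U.toSubgroup.FiniteIndex)
    {T L : Subgroup c.G} (hT : T ≤ U.toSubgroup) (hL : ¬ L ≤ U.toSubgroup) (g : Ghat) :
    ¬ L.map ι.toMonoidHom ≤ MulAut.conj g • (T.map ι.toMonoidHom).topologicalClosure := by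
  intro h
  obtain ⟨V, hUV⟩ := hι.comap_surjective U hU
  apply hL
  intro x hx
  have hVc : IsClosed (V.toSubgroup : Set Ghat) := V.toSubgroup.isClosed_of_isOpen V.isOpen'
  have hTV : (T.map ι.toMonoidHom).topologicalClosure ≤ V.toSubgroup :=
    Subgroup.topologicalClosure_minimal _ (Subgroup.map_le_iff_le_comap.2 (hT.trans (le_of_eq hUV))) hVc
  have hx' : ι.toMonoidHom x ∈ MulAut.conj g • (T.map ι.toMonoidHom).topologicalClosure := h ⟨x, hx, rfl⟩
  obtain ⟨y, hy, hxy⟩ := (Subgroup.mem_smul_pointwise_iff_exists _ _ _).1 hx'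
  rw [hUV, Subgroup.mem_comap, ← hxy, MulAut.smul_def, MulAut.conj_apply]
  exact V.isNormal'.conj_mem y (hTV hy) g

include hι in
/-- **`hF` ⟸ TEMPERED-LEVEL SEPARATION** (sufficient criterion): if for every edge `e` no branch of which abuts a vertex of
`ℍ`, and every edge-like `L` of `e`, some open normal finite-index `U ⊴ Π^tp_𝔾` contains `Π^tp_ℍ := TpH` but not `L`
(i.e. a finite quotient of `Π^tp_𝔾` kills `Π^tp_ℍ` and not `L`), then the pro-`Σ̂` edge–subgraph incidence `hF`
(G-w4d059-g8-1) holds — the hypothesis of `hF` is never met at such edges. [cite: MochizukiSemiAnbd2006, Prop 3.6(iii) p.38] -/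
theorem hatEdgeIncidence_of_openNormalSeparating
    (hsep : ∀ e : 𝒢.graph.Edge,
      (¬ ∃ b : 𝒢.graph.Branch, 𝒢.graph.edgeOf b = e ∧ ∃ w ∈ H.verts, 𝒢.graph.abuts b = some w) →
      ∀ L ∈ edgeLikeSubgroups c e, ∃ U : OpenNormalSubgroup c.G,
        U.toSubgroup.FiniteIndex ∧ TpH ≤ U.toSubgroup ∧ ¬ L ≤ U.toSubgroup) :
    ∀ e : 𝒢.graph.Edge, ∀ L ∈ edgeLikeSubgroups c e, ∀ g : Ghat,
      L.map ι.toMonoidHom ≤ MulAut.conj g • (TpH.map ι.toMonoidHom).topologicalClosure →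
        ∃ b : 𝒢.graph.Branch, 𝒢.graph.edgeOf b = e ∧ ∃ w ∈ H.verts, 𝒢.graph.abuts b = some w := by
  intro e L hL g hg
  by_contra habut
  obtain ⟨U, hU, hT, hLU⟩ := hsep e habut L hL
  exact not_map_le_conj_closure_of_openNormal c hι U hU hT hLU g hg

include hι in
/-- **Open-edge twin** (for abc-iut-w4-d059's `hFcusp`): separation is asked only of the OPEN edges not abutting `ℍ`.
[cite: MochizukiSemiAnbd2006, Prop 3.6(iii) p.38] -/
theorem hatCuspIncidence_of_openNormalSeparating
    (hsep : ∀ e : 𝒢.graph.Edge, (∃ b₀ : 𝒢.graph.Branch, 𝒢.graph.edgeOf b₀ = e ∧ 𝒢.graph.abuts b₀ = none) →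
      (¬ ∃ b : 𝒢.graph.Branch, 𝒢.graph.edgeOf b = e ∧ ∃ w ∈ H.verts, 𝒢.graph.abuts b = some w) →
      ∀ L ∈ edgeLikeSubgroups c e, ∃ U : OpenNormalSubgroup c.G,
        U.toSubgroup.FiniteIndex ∧ TpH ≤ U.toSubgroup ∧ ¬ L ≤ U.toSubgroup) :
    ∀ e : 𝒢.graph.Edge, (∃ b₀ : 𝒢.graph.Branch, 𝒢.graph.edgeOf b₀ = e ∧ 𝒢.graph.abuts b₀ = none) →
      ∀ L ∈ edgeLikeSubgroups c e, ∀ g : Ghat,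
        L.map ι.toMonoidHom ≤ MulAut.conj g • (TpH.map ι.toMonoidHom).topologicalClosure →
          ∃ b : 𝒢.graph.Branch, 𝒢.graph.edgeOf b = e ∧ ∃ w ∈ H.verts, 𝒢.graph.abuts b = some w := by
  intro e he L hL g hg
  by_contra habut
  obtain ⟨U, hU, hT, hLU⟩ := hsep e he habut L hL
  exact not_map_le_conj_closure_of_openNormal c hι U hU hT hLU g hg

end Chart

/-! ### 2. Row `IUTchI:Cor2.3(vi)` over abc-iut-L3's origin record, from the TEMPERED-LEVEL separation -/

section PiData

variable {p : ℕ} [Fact p.Prime] (X : TemperedCurve p) (d : X.GroupLevelData)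
  (S : SpecialFibreData (X.toTemperedArithmeticGroup d)) (h36 : S.Gc.Prop36Hypotheses)
  (Sigma SigmaHat : Set ℕ) (hsub : Sigma ⊆ SigmaHat) (hne : Sigma.Nonempty)
  (hprime : ∀ q ∈ SigmaHat, q.Prime) (hp : p ∉ Sigma)
  (TpH : Subgroup S.chart.G)
  {T : SpecialFibreTower X.DeltaTemp} (P : SpecialFibreTower.PiData X d S T)

/-- **Row `IUTchI:Cor2.3(vi)` over the origin record, PRINT'S record-vertex atom, any `Π^tp_ℍ := TpH ∈ decompSubgroups S.chart
P.H`** ⟸ {`hdict : P.CuspOpenEdgeDict` (ORIGIN record datum), `hsep` (TEMPERED-LEVEL separation of the open edges not abutting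
`ℍ` from `Π^tp_ℍ` by finite quotients)} — abc-iut-L5-d5's knit (p496337) with `hFcusp := hatCuspIncidence_of_openNormalSeparating`
at the datum's completion (`IsProfiniteCompletion` = `(exists_completion_of_prop36 …).choose_spec.choose_spec.1`).  FQ type per
the gate rule. [cite: Mochizuki2012, Cor 2.3(vi) pp.48-49] [claim: Mochizuki2012, status: disputed] -/
theorem cor23vi_ofSpecialFibre_closureH_of_piData_of_openNormalSeparating_of_cuspOpenEdgeDict
    (hdict : P.CuspOpenEdgeDict) (i : ℕ) (hTpH : TpH ∈ S.chart.decompSubgroups P.H)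
    (hsep : ∀ e : S.Gc.graph.Edge, (∃ b₀ : S.Gc.graph.Branch, S.Gc.graph.edgeOf b₀ = e ∧ S.Gc.graph.abuts b₀ = none) →
      (¬ ∃ b : S.Gc.graph.Branch, S.Gc.graph.edgeOf b = e ∧ ∃ w ∈ P.H.verts, S.Gc.graph.abuts b = some w) →
      ∀ L ∈ edgeLikeSubgroups S.chart e, ∃ U : OpenNormalSubgroup S.chart.G,
        U.toSubgroup.FiniteIndex ∧ TpH ≤ U.toSubgroup ∧ ¬ L ≤ U.toSubgroup) :
    Literature.IUT.HodgeTheaters.StableCurveTemperedData.Cor23vi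
        (ofSpecialFibre X d S h36 Sigma SigmaHat hsub hne hprime hp TpH ((TpH.map
          (TemperedGraphGroupData.exists_completion_of_prop36 S.Gc h36 S.chart).choose_spec.choose.toMonoidHom
          ).topologicalClosure) (Subgroup.le_topologicalClosure _)
          (fun x => (P.proj i).vertexMap (P.vtxOfCusp i x) ∈ P.H.verts)) :=
  cor23vi_ofSpecialFibre_closureH_of_piData_of_hatCuspIncidence_of_cuspOpenEdgeDict X d S h36 Sigma SigmaHat hsub hne hprime
    hp TpH P hdict i hTpH
    (hatCuspIncidence_of_openNormalSeparating S.chart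
      (TemperedGraphGroupData.exists_completion_of_prop36 S.Gc h36 S.chart).choose_spec.choose_spec.1 P.H TpH hsep)

/-- **The same for abc-iut-L5-d5's GROUP-form atom at the record's `Π^tp_ℍ := P.TpH`** ⟸ {`hdict`, `hsep` at `P.TpH`} (via
this lineage's `hatIncidence_verticialOver_of_hatCuspIncidence_of_cuspOpenEdgeDict`, p497321).  FQ type per the gate rule.
[cite: Mochizuki2012, Cor 2.3(vi) pp.48-49] [claim: Mochizuki2012, status: disputed] -/
theorem cor23vi_ofSpecialFibre_verticialOver_piDataTpH_of_openNormalSeparating_of_cuspOpenEdgeDict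
    (hdict : P.CuspOpenEdgeDict)
    (hsep : ∀ e : S.Gc.graph.Edge, (∃ b₀ : S.Gc.graph.Branch, S.Gc.graph.edgeOf b₀ = e ∧ S.Gc.graph.abuts b₀ = none) →
      (¬ ∃ b : S.Gc.graph.Branch, S.Gc.graph.edgeOf b = e ∧ ∃ w ∈ P.H.verts, S.Gc.graph.abuts b = some w) →
      ∀ L ∈ edgeLikeSubgroups S.chart e, ∃ U : OpenNormalSubgroup S.chart.G,
        U.toSubgroup.FiniteIndex ∧ P.TpH ≤ U.toSubgroup ∧ ¬ L ≤ U.toSubgroup) :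
    Literature.IUT.HodgeTheaters.StableCurveTemperedData.Cor23vi
        (ofSpecialFibre X d S h36 Sigma SigmaHat hsub hne hprime hp P.TpH ((P.TpH.map
          (TemperedGraphGroupData.exists_completion_of_prop36 S.Gc h36 S.chart).choose_spec.choose.toMonoidHom
          ).topologicalClosure) (Subgroup.le_topologicalClosure _)
          (fun x => ∃ v ∈ P.H.verts, ∃ K ∈ verticialSubgroups S.chart v,
            ((X.inertia x.1).subgroupOf (X.toTemperedArithmeticGroup d).delta).map S.admissible.toMonoidHom ≤ K)) :=
  cor23vi_ofSpecialFibre_verticialOver_piDataTpH X d S h36 Sigma SigmaHat hsub hne hprime hp P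
    (hatIncidence_verticialOver_of_hatCuspIncidence_of_cuspOpenEdgeDict X d S h36 P.TpH P hdict
      (hatCuspIncidence_of_openNormalSeparating S.chart
        (TemperedGraphGroupData.exists_completion_of_prop36 S.Gc h36 S.chart).choose_spec.choose_spec.1 P.H P.TpH hsep))

end PiData

end StableCurveTemperedData

end Literature.IUT.HodgeTheaters

end
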